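import Summits.BirchSwinnertonDyer.BirchSwinnertonDyer.Theorems.ErratumRoadFiveIMCDivClassicalAtomsB
import Summits.BirchSwinnertonDyer.BirchSwinnertonDyer.Theorems.ErratumRoadFiveRest3BranchesDefs
import Summits.BirchSwinnertonDyer.BirchSwinnertonDyer.Theorems.ClassRecordThreeStepLOfHalvesB
import HarnessLib

/-!
# Route `ErratumRoadFive` (K2, `p ≥ 5`), crux (T) `Rest3TorsionBranchAtFive` (item 19702) ∕ (NW) 19703 — the
# T = 0 RE-THREAD over the ORIENTATION-REPAIRED classical atoms: `P2OpenInputOnTreeAt` ⟸ H∃♭ᴮ, H∃♭ᴮ ⟸ (2.4)∃♭ᴮ +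
# the JIMJ18 display, and the branches (T) ∕ (NW) ⟸ (2.4)∃♭ᴮ on their rows (census addendum A-3, bdp g16)

Cell `bsd-stepL` (run/shared/lean/pub/bsd-stepL/), seat `bsd-stepL-bdp` (prover g16, 2026-08-27).
`--supports stmt-BirchSwinnertonDyer-19702 --as helper`. Theorems only (no definition, no named fact, no `sorry`).

WHAT. The twins, over the oriented atoms `P2.IMCDivSomeFrameOnTreeB` ∕ `P2.IMCDivIntFrameOnTreeB`
(`Theorems/ErratumRoadFiveIMCDivClassicalAtomsB.lean`), of multr1-p2 gen 29's
`P2.openInputOnTreeAt_of_imcDivIntFrame(_of_controlUpper)` (`X11b/BDPRouteOpenInputIntFrame.lean`), of bdp g12's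
`imcDivIntFrameOnTree_of_imcDivSomeFrame_of_pNew` ∕ `openInputOnTreeAt_of_imcDivSomeFrame_of_pNew`
(`Theorems/ErratumRoadFiveClassicalValueFromPrint.lean`) and of rest-p2's
`rest3TorsionBranchAtFive_of_imcDivSomeFrame_of_pNew` ∕ `rest3NoWitnessBranchAtFive_…`
(`Theorems/ErratumRoadFiveRest3BranchesDefs.lean`). The ONE changed step is the T = 0 passage: the control
`P2ControlUpperOnTreeAt` gives the valuation `n` of `X_ac` at the TARGET prime `𝔭` (X-slot); with the B-atom
the frame must then sit at the OTHER prime `𝔭′` (`Three.exists_ne_degreeOne_prime`; `𝔭′ = 𝔭_{ι′}` for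
`ι′ ∈ {ι₀, ι₀ ∘ conj}`, `eq_primeOfEmbeddingDatum_or_eq_trans_starRingAut`), whose value conjunct reads
`log_{ω_E}` through THE embedding at `𝔭′`; the assembly `R1.imcLowerWaldspurgerOnTreeAt_of_intValue_of_intDvd`
gives the link at X-slot `𝔭` with the logarithm at `embAt 𝔭′`, and the logarithm is moved to `embAt 𝔭` by
rank one (already in the A-proof: `mordellWeilRank_baseChange_eq_one_of_twist_ne_zero`) through
`embAt K p 𝔭′ = embAt K p 𝔭 ∘ σ` (door-c5 `exists_algEquiv_embAt_eq_comp`), `R1.padicLogOrd_map_eq_comp` and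
`R1.padicLogOrd_map_eq_of_rank_one`. Everything else is byte-identical to the A-proofs.

HONEST FRAMING: implications only; (2.4)∃♭ᴮ ∕ H∃♭ᴮ are OPEN (no printed supplier at these data); nothing is
discharged, booked or re-labelled (T7). References: [Castella2018] Thms. 2.3, 3.1, 3.2, §5 (arXiv:1704.06608
pp. 5, 9, 12); [Castella2018Exceptional] Thms. 2.10–2.11 (arXiv:1507.04260 pp. 13–14); [Castella2018Erratum]
(2.4) (p. 4); [MilneADT2006] I Thm. 4.10(b), Thm. 2.8; cell audit ORIENT-AUDIT-19270 Q4 (a) + (T0), RULING 4.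
-/

set_option autoImplicit false
set_option linter.dupNamespace false

noncomputable section

open scoped Classical NumberField Topology

open Filter WeierstrassCurve NumberField IsDedekindDomain Field PowerSeries
open Literature.NumberTheory.EllipticCurves Literature.NumberTheory.EllipticCurves.GreenbergSelmer
open Literature.NumberTheory.EllipticCurves.ModularForms
open Literature.NumberTheory.EllipticCurves.Rank1Residual
open Literature.NumberTheory.EllipticCurves.Rank1Residual.Typed
open Literature.NumberTheory.EllipticCurves.Castella2018
open Literature.NumberTheory.EllipticCurves.Castella2018Exceptional
open Literature.NumberTheory.GaloisRepresentations Literature.NumberTheory.GaloisCohomology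
open Literature.NumberTheory.Automorphic
open Summit.BirchSwinnertonDyer.Rank1Residual Summit.BirchSwinnertonDyer.Rank1Residual.X11b
open Summit.BirchSwinnertonDyer.Rank1Residual.X11b.AcSelmer
open Summit.BirchSwinnertonDyer.Rank1Residual.X11b.Halves
open Summit.BirchSwinnertonDyer.BirchSwinnertonDyer.Theorems.SchneiderFreeAdditiveX3

namespace Summit.BirchSwinnertonDyer.BirchSwinnertonDyer.Theorems.Rest3TorsionBranchB

variable {W : WeierstrassCurve ℚ} [W.IsElliptic] [W.IsGloballyMinimal] {p : ℕ} [Fact p.Prime]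

/-! ### §1 The T = 0 passage over H∃♭ᴮ -/

/-- **Route p2's open input `P2OpenInputOnTreeAt W p` ⟸ H∃♭ᴮ + one-sided control**, the ORIENTED twin of
`P2.openInputOnTreeAt_of_imcDivIntFrame_of_controlUpper`: at the target prime `𝔭` (X-slot, CTL valuation `n`)
the frame is taken at the conjugate prime `𝔭′ = 𝔭_{ι′}`, the divisibility conjunct of H∃♭ᴮ is read at
`𝔭bar := 𝔭 ≠ 𝔭′`, and the value's logarithm at `embAt 𝔭′` is moved to `embAt 𝔭` in rank one
(`embAt 𝔭′ = embAt 𝔭 ∘ σ`, `σ_* P = ±P + torsion`). CONDITIONAL on H∃♭ᴮ.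
[cite: Castella2018, Thms. 2.3, 3.1, 3.2 and §5 (arXiv:1704.06608 pp. 5, 9, 12)]
[cite: Castella2018Erratum, (2.4) and Thm. 1.1 (pp. 1, 4)] -/
theorem openInputOnTreeAt_of_imcDivIntFrameB_of_controlUpper (hnf : exists_isNewformOf)
    (hGZK : rank_eq_analyticRank_of_analyticRank_le_one) (hC : P2ControlUpperOnTreeAt W p)
    (ι₀ : PadicAlgCl p ≃+* ℂ) (hF : P2.IMCDivIntFrameOnTreeB W p) : P2OpenInputOnTreeAt W p := by
  intro N _ K _ _ Dt H ιK P hX h5 hs hN hK hodd hpd hμ hHN hLt hP hc hPinf κ hκ γ _ 𝔭 h𝔭 he hf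
  obtain ⟨n, hn, -⟩ := hC N K Dt H ιK P hX h5 hs hN hK hodd hpd hμ hHN hLt hP hc hPinf κ hκ γ 𝔭 h𝔭 he hf
  have hF' := hF N K Dt H ιK P hX h5 hs hN hK hodd hpd hμ hHN hLt hP hc hPinf κ hκ γ
  subst hN
  obtain ⟨hr, -, -, -⟩ := hX
  obtain ⟨w₀⟩ := (inferInstance : Nonempty (InfinitePlace K))
  have hp2 : p ≠ 2 := by omega
  -- `rank_ℤ E(K) = 1` (Gross–Zagier–Kolyvagin)
  have hrk : (W.baseChange K).mordellWeilRank = 1 :=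
    mordellWeilRank_baseChange_eq_one_of_twist_ne_zero W hGZK hnf hr hK.1 hLt
  -- the datum's complex embedding is `w₀.embedding ∘ τ` for some `τ ∈ Gal(K/ℚ)`, `τ² = 1`
  haveI : IsGalois ℚ K := by
    haveI : Algebra.IsQuadraticExtension ℚ K := ⟨hK.1⟩
    infer_instance
  obtain ⟨σ, hσ⟩ := ComplexEmbedding.exists_comp_symm_eq_of_comp_eq (k := ℚ) w₀.embedding ιK
    (by ext x; simp)
  set τ : K →+* K := ((σ.symm : K ≃ₐ[ℚ] K) : K →+* K) with hτdef
  have hτ : ∀ x, τ (τ x) = x := by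
    intro x
    have hcard : Nat.card (K ≃ₐ[ℚ] K) = 2 := by rw [IsGalois.card_aut_eq_finrank, hK.1]
    have hsq : σ.symm * σ.symm = 1 := by
      have h := pow_card_eq_one' (G := K ≃ₐ[ℚ] K) (x := σ.symm)
      rwa [hcard, pow_two] at h
    have := congrArg (fun g : K ≃ₐ[ℚ] K ↦ g x) hsq
    simpa [hτdef, AlgEquiv.mul_apply] using this
  -- the Galois conjugate `P' = τ_* P` is the Heegner point read through `w₀.embedding`
  set P' := WeierstrassCurve.Affine.Point.map τ.toRatAlgHom P with hP'def
  have hP' : WeierstrassCurve.Affine.Point.map w₀.embedding.toRatAlgHom P' =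
      heegnerPointComplex Dt H := by
    rw [hP'def, WeierstrassCurve.Affine.Point.map_map]
    have hcomp : w₀.embedding.toRatAlgHom.comp τ.toRatAlgHom = ιK.toRatAlgHom := by
      apply AlgHom.ext
      intro x
      have := RingHom.congr_fun hσ x
      simpa [hτdef] using this
    rw [hcomp]
    exact hP
  have hlog : ∀ e : K →+* ℚ_[p], X11b.padicLogOrd W p e P' = X11b.padicLogOrd W p e P := fun e ↦
    R1.padicLogOrd_map_eq_of_rank_one W p e P hp2 τ hτ hrk hPinf
  -- the OTHER degree-one prime `𝔭₁` above `p`, and the log symmetry `𝔭 ↔ 𝔭₁` in rank one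
  obtain ⟨𝔭₁, hne, h𝔭₁, he₁, hf₁⟩ := Three.exists_ne_degreeOne_prime hK.1 (p := p) h𝔭 he hf
  have hsymm : X11b.padicLogOrd W p (embAt K p 𝔭₁ h𝔭₁ he₁ hf₁) P =
      X11b.padicLogOrd W p (embAt K p 𝔭 h𝔭 he hf) P := by
    obtain ⟨ρ, -, hρρ, happ⟩ := exists_algEquiv_embAt_eq_comp (p := p) hK.1 h𝔭 he hf h𝔭₁ he₁ hf₁ hne
    have hcompρ : (embAt K p 𝔭 h𝔭 he hf).comp (ρ : K →+* K) = embAt K p 𝔭₁ h𝔭₁ he₁ hf₁ :=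
      RingHom.ext fun x => (happ x).symm
    rw [← hcompρ, ← R1.padicLogOrd_map_eq_comp]
    exact R1.padicLogOrd_map_eq_of_rank_one W p _ P hp2 (ρ : K →+* K) (fun x => hρρ x) hrk hPinf
  -- THE embedding at `𝔭₁` induces `𝔭₁`
  have hemb₁ : ∀ k : 𝓞 K, k ∈ 𝔭₁.asIdeal ↔ ‖embAt K p 𝔭₁ h𝔭₁ he₁ hf₁ (k : K)‖ < 1 :=
    mem_asIdeal_iff_norm_embAt_lt_one 𝔭₁ h𝔭₁ he₁ hf₁
  -- frame at `𝔭₁ = 𝔭_{ι'}`, divisibility at `𝔭bar := 𝔭`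
  have key : ∀ ι' : PadicAlgCl p ≃+* ℂ, 𝔭₁ = primeOfEmbeddingDatum p ι' w₀.embedding →
      IMCLowerWaldspurgerOnTreeAt p κ 𝔭 γ (embAt K p 𝔭 h𝔭 he hf) P := by
    intro ι' h𝔭eq
    obtain ⟨ΩK, Ωp, Q, -, -, -, ⟨u, hu1, hu⟩, hdivB⟩ :=
      hF' ι' w₀ P' hP' (embAt K p 𝔭₁ h𝔭₁ he₁ hf₁) (by rw [← h𝔭eq]; exact hemb₁)
    have hdiv := hdivB 𝔭 h𝔭 (by rw [← h𝔭eq]; exact hne.symm)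
    have h₁ : IMCLowerWaldspurgerOnTreeAt p κ 𝔭 γ (embAt K p 𝔭₁ h𝔭₁ he₁ hf₁) P :=
      imcLowerWaldspurgerOnTreeAt_of_padicLogOrd_eq W p _ (hlog _)
        (R1.imcLowerWaldspurgerOnTreeAt_of_intValue_of_intDvd hn hdiv hu1.le (W.LFunction p) hu)
    obtain ⟨m, hm, hle⟩ := h₁
    exact ⟨m, hm, by rw [← hsymm]; exact hle⟩
  rcases eq_primeOfEmbeddingDatum_or_eq_trans_starRingAut p ι₀ hK w₀ h𝔭₁ with h | h
  · exact key ι₀ h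
  · exact key _ h

/-- **`P2OpenInputOnTreeAt W p` ⟸ H∃♭ᴮ, on every pair** (control from `hKo`, `hPT`, `hEP`:
`p2ControlUpperOnTreeAt_of_facts`; Steinitz `ι₀`). The oriented twin of `P2.openInputOnTreeAt_of_imcDivIntFrame`.
[cite: Castella2018, Thms. 2.3, 3.1, 3.2, §5 (arXiv:1704.06608 pp. 5, 9, 12)]
[cite: Castella2018Erratum, (2.4) (p. 4)] [cite: MilneADT2006, Ch. I, Thm. 4.10(b) and Thm. 2.8] -/
theorem openInputOnTreeAt_of_imcDivIntFrameB (hnf : exists_isNewformOf)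
    (hGZK : rank_eq_analyticRank_of_analyticRank_le_one)
    (hKo : ∀ (N : ℕ) [NeZero N] (W : WeierstrassCurve ℚ) (K : Type) [Field K] [NumberField K],
      kolyvagin N W K)
    (hPT : ∀ (K : Type) [Field K] [NumberField K], poitouTate_sum_localTatePairing_eq_zero K)
    (hEP : ∀ (K : Type) [Field K] [NumberField K] (v : HeightOneSpectrum (𝓞 K)),
      localEulerPoincareCharacteristic (v.adicCompletion K))
    (hF : P2.IMCDivIntFrameOnTreeB W p) : P2OpenInputOnTreeAt W p := by
  obtain ⟨ι₀⟩ := PadicAlgCl.nonempty_ringEquiv_complex p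
  exact openInputOnTreeAt_of_imcDivIntFrameB_of_controlUpper hnf hGZK
    (p2ControlUpperOnTreeAt_of_facts W p hKo hPT hEP) ι₀ hF

/-! ### §2 H∃♭ᴮ from (2.4)∃♭ᴮ and the JIMJ18 display; the branches (T) and (NW) over (2.4)∃♭ᴮ -/

/-- **H∃♭ᴮ ⟸ (2.4)∃♭ᴮ + the JIMJ18 display** — the oriented twin of bdp g12's
`imcDivIntFrameOnTree_of_imcDivSomeFrame_of_pNew`: the value at `𝟙` of the SAME frame from the continuity display
(`continuousDisplayOnTree_of_pNew`, one-sided ♭-rigidity); the divisibility conjunct passes through untouched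
(it is the only slot the repair moved). CONDITIONAL on the fact and on (2.4)∃♭ᴮ.
[cite: Castella2018Exceptional, Thms. 2.10–2.11 (arXiv:1507.04260 pp. 13–14)]
[cite: Castella2018, Thms. 3.1–3.2 (arXiv:1704.06608 p. 9)] [cite: Castella2018Erratum, (2.4) (p. 4)] -/
theorem imcDivIntFrameOnTreeB_of_imcDivSomeFrameB_of_pNew (hB : thm210_thm211_bdpDisplay_pNew)
    (hD : P2.IMCDivSomeFrameOnTreeB W p) : P2.IMCDivIntFrameOnTreeB W p := by
  intro N _ K _ _ Dt H ιK P hX h5 hs hN hK hodd hpd hμ hHN hLt hP hc hPinf κ hκ γ hγ ι' w₀ P' hP' e he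
  obtain ⟨ΩK, Ωp, Q, hΩK, hΩp, hQ, hdiv⟩ :=
    hD N K Dt H ιK P hX h5 hs hN hK hodd hpd hμ hHN hLt hP hc hPinf κ hκ γ ι' w₀ P' hP' e he
  obtain ⟨ΩK₀, Ωp₀, u, hΩK₀, hΩp₀, hu, hc0, hcont⟩ := continuousDisplayOnTree_of_pNew hB N K Dt H ιK P
    hX h5 hs hN hK hodd hpd hμ hHN hLt hP hc hPinf κ hκ γ ι' w₀ P' hP' e he
  have hΩp0 : Ωp ≠ 0 := fun h ↦ by rw [h, norm_zero] at hΩp; exact zero_ne_one hΩp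
  have heq := intSeries_constantCoeff_eq_of_isBDPLFunctionInt_of_continuousValues hX.2.1 hK hκ hγ.out
    hΩK₀ hΩK hΩp₀ hΩp0 hcont hc0 hQ
  refine ⟨ΩK, Ωp, Q, hΩK, hΩp, hQ, ⟨u, hu, ?_⟩, hdiv⟩
  rw [← heq]
  exact R1.intSeries_hasValueAt_zero p Q

/-- **`P2OpenInputOnTreeAt W p` ⟸ (2.4)∃♭ᴮ AT THE PAIR + published and cited facts** (oriented twin of bdp
g12's `openInputOnTreeAt_of_imcDivSomeFrame_of_pNew`). [cite: Castella2018Exceptional, Thms. 2.10–2.11 (arXiv:1507.04260 pp. 13–14)]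
[cite: Castella2018, Thms. 2.3, 3.1, 3.2, §5 (arXiv:1704.06608 pp. 5, 9, 12)] [cite: Castella2018Erratum, (2.4) (p. 4)] -/
theorem openInputOnTreeAt_of_imcDivSomeFrameB_of_pNew (hnf : exists_isNewformOf)
    (hGZK : rank_eq_analyticRank_of_analyticRank_le_one)
    (hKo : ∀ (N : ℕ) [NeZero N] (W : WeierstrassCurve ℚ) (K : Type) [Field K] [NumberField K],
      kolyvagin N W K)
    (hPT : ∀ (K : Type) [Field K] [NumberField K], poitouTate_sum_localTatePairing_eq_zero K)
    (hEP : ∀ (K : Type) [Field K] [NumberField K] (v : HeightOneSpectrum (𝓞 K)),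
      localEulerPoincareCharacteristic (v.adicCompletion K))
    (hB : thm210_thm211_bdpDisplay_pNew) (hD : P2.IMCDivSomeFrameOnTreeB W p) :
    P2OpenInputOnTreeAt W p :=
  openInputOnTreeAt_of_imcDivIntFrameB hnf hGZK hKo hPT hEP
    (imcDivIntFrameOnTreeB_of_imcDivSomeFrameB_of_pNew hB hD)

/-- **Branch (T) (item 19702) ⟸ the ORIENTED value-free shape (2.4)∃♭ᴮ on its rows + print** — the twin of
rest-p2's `rest3TorsionBranchAtFive_of_imcDivSomeFrame_of_pNew` over `P2.IMCDivSomeFrameOnTreeB`; the shape the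
re-registered stub `stub_t_imcDivSomeFrame`ᴮ should have. CONDITIONAL; no road to (2.4)∃♭ᴮ is claimed.
[cite: Castella2018Exceptional, Thms. 2.10–2.11 (arXiv:1507.04260 pp. 13–14)]
[cite: Castella2018Erratum, (2.4) (p. 4)] [cite: Castella2018, Thms. 2.3, 3.1, 3.2, §5]
[cite: MilneADT2006, Ch. I, Thm. 4.10(b) and Thm. 2.8] -/
theorem rest3TorsionBranchAtFive_of_imcDivSomeFrameB_of_pNew (hnf : exists_isNewformOf)
    (hGZK : rank_eq_analyticRank_of_analyticRank_le_one)
    (hKo : ∀ (N : ℕ) [NeZero N] (W : WeierstrassCurve ℚ) (K : Type) [Field K] [NumberField K],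
      kolyvagin N W K)
    (hPT : ∀ (K : Type) [Field K] [NumberField K], poitouTate_sum_localTatePairing_eq_zero K)
    (hEP : ∀ (K : Type) [Field K] [NumberField K] (v : HeightOneSpectrum (𝓞 K)),
      localEulerPoincareCharacteristic (v.adicCompletion K))
    (hB : thm210_thm211_bdpDisplay_pNew)
    (hDiv : ∀ (W : WeierstrassCurve ℚ) [W.IsElliptic] [W.IsGloballyMinimal] (p : ℕ) [Fact p.Prime],
      Ram W p → (∃ P : (W.baseChange ℚ_[p]).toAffine.Point, p • P = 0 ∧ P ≠ 0) →
      P2.IMCDivSomeFrameOnTreeB W p) :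
    Rest3TorsionBranchAtFive :=
  fun W _ _ p _ hram hP ↦
    openInputOnTreeAt_of_imcDivSomeFrameB_of_pNew hnf hGZK hKo hPT hEP hB (hDiv W p hram hP)

/-- **Branch (NW) (item 19703) ⟸ the ORIENTED value-free shape (2.4)∃♭ᴮ on its rows + print** (twin of
`rest3NoWitnessBranchAtFive_of_imcDivSomeFrame_of_pNew`). CONDITIONAL; no road to (2.4)∃♭ᴮ is claimed.
[cite: Castella2018Exceptional, Thms. 2.10–2.11 (arXiv:1507.04260 pp. 13–14)]
[cite: Castella2018Erratum, (2.4) (p. 4)] [cite: Castella2018, Thms. 2.3, 3.1, 3.2, §5] -/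
theorem rest3NoWitnessBranchAtFive_of_imcDivSomeFrameB_of_pNew (hnf : exists_isNewformOf)
    (hGZK : rank_eq_analyticRank_of_analyticRank_le_one)
    (hKo : ∀ (N : ℕ) [NeZero N] (W : WeierstrassCurve ℚ) (K : Type) [Field K] [NumberField K],
      kolyvagin N W K)
    (hPT : ∀ (K : Type) [Field K] [NumberField K], poitouTate_sum_localTatePairing_eq_zero K)
    (hEP : ∀ (K : Type) [Field K] [NumberField K] (v : HeightOneSpectrum (𝓞 K)),
      localEulerPoincareCharacteristic (v.adicCompletion K))
    (hB : thm210_thm211_bdpDisplay_pNew)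
    (hDiv : ∀ (W : WeierstrassCurve ℚ) [W.IsElliptic] [W.IsGloballyMinimal] (p : ℕ) [Fact p.Prime],
      Ram W p → (∀ P : (W.baseChange ℚ_[p]).toAffine.Point, p • P = 0 → P = 0) →
      ¬ (∃ (q : ℕ) (_ : Fact q.Prime), q ≠ 2 ∧ q ≠ p ∧ Mult W q ∧
          ¬ W.HasSplitMultiplicativeReductionAtPrime q ∧ ¬ p ∣ padicValInt q W.minimalDiscriminantInt) →
      P2.IMCDivSomeFrameOnTreeB W p) :
    Rest3NoWitnessBranchAtFive :=
  fun W _ _ p _ hram htors hno ↦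
    openInputOnTreeAt_of_imcDivSomeFrameB_of_pNew hnf hGZK hKo hPT hEP hB (hDiv W p hram htors hno)

end Summit.BirchSwinnertonDyer.BirchSwinnertonDyer.Theorems.Rest3TorsionBranchB

end
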